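import Mathlib
import Literature.MathematicalPhysics.StatisticalMechanics.Crystallization
import Literature.Geometry.DiscreteGeometry.KissingPatterns

/-!
# Sketch — crux-ideate stmt-AtomisticToContinuum-13603 (DefectFreeCrystallizes), ideator 3

First lemmas of the idea cards (they need not be proved here; they must elaborate).

* Card `octet-cell-squeeze`: `OctahedronCoercivity` (first lemma) and `WindowPinningUpper`
  (second stub, the arsenal's window pinning in finite-N form).
* Card `sitewise-pairing-slack`: `SitewiseEarliestReturn` (first lemma, pure combinatorics).
-/

noncomputable section

open scoped BigOperators InnerProductSpace
open Literature.MathematicalPhysics.StatisticalMechanics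

namespace Summit.AtomisticToContinuum.Crystallization.Cruxes.DefectFreeCrystallizes.Ideator3

local notation "E3" => EuclideanSpace ℝ (Fin 3)

/-- The six vertices `± (a/√2) e_k` of the regular octahedron of edge length `a` centred at the
origin (the octahedral interstice of a close packing with nearest-neighbour distance `a`). -/
def octVertex (a : ℝ) : Fin 6 → E3 :=
  ![ (a / Real.sqrt 2) • EuclideanSpace.single (0 : Fin 3) (1 : ℝ),
    -((a / Real.sqrt 2) • EuclideanSpace.single (0 : Fin 3) (1 : ℝ)),
     (a / Real.sqrt 2) • EuclideanSpace.single (1 : Fin 3) (1 : ℝ),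
    -((a / Real.sqrt 2) • EuclideanSpace.single (1 : Fin 3) (1 : ℝ)),
     (a / Real.sqrt 2) • EuclideanSpace.single (2 : Fin 3) (1 : ℝ),
    -((a / Real.sqrt 2) • EuclideanSpace.single (2 : Fin 3) (1 : ℝ)) ]

/-- The OCTAHEDRAL CELL FUNCTIONAL: every one of the 15 vertex pairs of an octahedral cell carries
Lennard-Jones energy with weight `1/2` (the 12 edges are nearest-neighbour bonds, each bordering
exactly two octahedra of the tet/oct tiling of a close packing) and the three diagonals
`(0,1), (2,3), (4,5)` (second-neighbour bonds, interior to exactly one octahedron) carry an extra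
`1/2`, i.e. total weight `1`.  Summed over the octahedra of a Barlow stacking this is exactly the
bond energy out to distance `√2·a`; tetrahedra carry no energy. -/
def PhiOct (p : Fin 6 → E3) : ℝ :=
  (1 / 2) * (∑ i : Fin 6, ∑ j ∈ Finset.Ioi i, lennardJones (dist (p i) (p j))) +
  (1 / 2) * (lennardJones (dist (p 0) (p 1)) + lennardJones (dist (p 2) (p 3)) +
    lennardJones (dist (p 4) (p 5)))

/-- FIRST LEMMA of card `octet-cell-squeeze` — OCTAHEDRON COERCIVITY (inner band, local form).
For nearest-neighbour scales `a ∈ [19/20, 1]` (which contains the relaxed LJ spacing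
`a* ≈ 0.9712` and the O(1/R) strains) the octahedral cell functional is uniformly coercive
transversally to the 12-dimensional space of affine velocity fields `v i = A (q i) + b`:
a non-affine perturbation `v` of size `≤ ε₀` raises `PhiOct` by at least `c · Σ ‖v i‖²`.
(No linear term is needed: by symmetry the gradient of `PhiOct` at the regular octahedron is the
radial field, which is affine, hence orthogonal to `v`.)  Certified content: the 6×6 reduced
Hessian is positive definite uniformly on the scale interval (interval arithmetic on
`V'' , V'/r` at `a` and `√2 a`) plus a third-derivative remainder bound. -/
def OctahedronCoercivity : Prop :=
  ∃ c ε₀ : ℝ, 0 < c ∧ 0 < ε₀ ∧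
    ∀ a : ℝ, 19 / 20 ≤ a → a ≤ 1 →
    ∀ v : Fin 6 → E3,
      (∀ (A : E3 →ₗ[ℝ] E3) (b : E3), ∑ i : Fin 6, ⟪v i, A (octVertex a i) + b⟫_ℝ = 0) →
      ∑ i : Fin 6, ‖v i‖ ^ 2 ≤ ε₀ ^ 2 →
      PhiOct (octVertex a) + c * ∑ i : Fin 6, ‖v i‖ ^ 2 ≤ PhiOct (fun i => octVertex a i + v i)

/-- The self-energy of the part of a finite configuration inside the closed ball `B(c,R)`:
pairs with BOTH ends in the ball. -/
def windowSelfEnergy {N : ℕ} (x : Fin N → E3) (c : E3) (R : ℝ) : ℝ :=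
  ∑ i : Fin N, ∑ j ∈ Finset.Ioi i,
    if dist (x i) c ≤ R ∧ dist (x j) c ≤ R then lennardJones (dist (x i) (x j)) else 0

/-- SECOND STUB of card `octet-cell-squeeze` — WINDOW PINNING, UPPER HALF (finite-N form of the
arsenal's sub-cluster pinning: cut the window out, paste a clipped near-optimal periodic block,
compare with `E(N-k) ≥ E(N) - E(k)`; the cross terms across a sphere are `O(R²)` by the hard core
`LennardJonesMinimalDistance` and the summable `r⁻⁶` tail).  Every window of every Lennard-Jones
ground state has self-energy at most `(number of particles in it) · e* + C R²`, where
`e* = ⨅` over periodic configurations of the energy per particle. -/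
def WindowPinningUpper : Prop :=
  ∃ C : ℝ, ∀ (N : ℕ) (x : Fin N → E3), IsGroundState lennardJones x →
    ∀ (c : E3) (R : ℝ), 1 ≤ R →
      windowSelfEnergy x c R ≤
        (Nat.card {i : Fin N // dist (x i) c ≤ R} : ℝ) *
            (⨅ Q : PeriodicConfiguration 3, Q.energyPerParticle lennardJones) +
          C * R ^ 2

/-- FIRST LEMMA of card `sitewise-pairing-slack` — SITEWISE EARLIEST RETURN (pure combinatorics,
no potential).  For a Barlow registry word `σ : ℕ → Fin 3` (adjacent layers differ) and
non-negative ANTITONE weights `w`, the one-sided return sum seen from layer `m`,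
`Σ_{k=1}^{n} w k · [σ (m+k) = σ m]`, is at most the hcp value `Σ_{j : 2j ≤ n} w (2j)`, and it
drops by at least `w 2 - w 3` as soon as layer `m` sees a cubic relation `σ (m+2) ≠ σ m`.
(Row-by-row earliest-return majorisation: the `k`-th return of the letter `σ m` happens at time
`≥ 2k`, and at time `≥ 2k+1` for every `k` once the first return is missed.)  This is the
SITE-ENERGY form of the monotone-pairing lemma: it resolves the far-field reference energy of a
single site by its visible registry letters, which is what the squeeze consumes. -/
def SitewiseEarliestReturn : Prop :=
  ∀ (w : ℕ → ℝ), (∀ k, 0 ≤ w k) → Antitone w →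
  ∀ (σ : ℕ → Fin 3), (∀ i, σ (i + 1) ≠ σ i) →
  ∀ (m n : ℕ),
    (∑ k ∈ Finset.Icc 1 n, (if σ (m + k) = σ m then w k else 0)) ≤
        ∑ j ∈ Finset.Icc 1 (n / 2), w (2 * j) ∧
    (σ (m + 2) ≠ σ m → 2 ≤ n →
      (∑ k ∈ Finset.Icc 1 n, (if σ (m + k) = σ m then w k else 0)) + (w 2 - w 3) ≤
        ∑ j ∈ Finset.Icc 1 (n / 2), w (2 * j))

end Summit.AtomisticToContinuum.Crystallization.Cruxes.DefectFreeCrystallizes.Ideator3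

end
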